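import Mathlib
import Summits.NavierStokesRegularity.NavierStokesRegularity.Theorems.TaoLadderRungTwoBreakBlowupRigidityOneRenormalisedViscousFlow
import Summits.NavierStokesRegularity.NavierStokesRegularity.Theorems.TaoLadderRungTwoBreakBlowupRigidityOneViscousEnergyBound
import HarnessLib

/-!
# The RENORMALISED VISCOUS BLOW-UPS of a robustly blowing-up table: for every small viscosity the maximal
  `ν`-viscous flow, its energy bound and high-shell blow-up, and its renormalisation solving the
  `IsEternalVisc` law (covariant viscosity) on a half-line — assembly, the `ν ≥ 0` companion of
  `blowupProfile_of_noGlobalCascade` (support for K2(1)/K2ᵛ(1): stmt-NavierStokesRegularity-20206, ⟨20420⟩, ⟨22743⟩)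

MODEL lattice ODEs only (Tao 2016 §4, the viscous lattice before Thm. 4.2, §6.4); nothing here is a statement
about the Navier–Stokes equations; NO item is closed (`--supports stmt-NavierStokesRegularity-20206`).
Route-independent; general `m`.

* `viscousBlowupProfile_of_noGlobalCascade` — from `NoGlobalCascade ε₀ α X₀` (`α ∈ E₂(R)`): `κ > 0` such that
  for EVERY `0 ≤ ν ≤ κ/√2` there are a blow-up time `T > 0` and the maximal `ν`-viscous flow `X` (datum, no
  shells below `0`, viscous motion, (4.5)-regular before `T`, amplitudes `≤ ‖X₀‖`, (4.5)-norm blow-up realised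
  on shells `k → ∞`), whose renormalisation `W_n(σ) = Λ^n e^{-σ} x_n(T - e^{-σ})` satisfies the law of
  `IsEternalVisc ε₀ ν α` (covariant viscosity `ν(1+ε₀)^{2n}e^{-σ}`) at every `σ` with `e^{-σ} < T`. This is
  the trajectory the crux ⟨22743⟩ `WakeRatchet.MinimalViscousBlowup` wants to be critically pinned at a
  selected `ν`, here produced for all small `ν` directly from the hypothesis of K2(1)/K2ᵛ(1).
-/

noncomputable section

-- the summit and its single sub-problem share the name (CONVENTIONS §1)
set_option linter.dupNamespace false

open Set Filter Topology

namespace Summit.NavierStokesRegularity.NavierStokesRegularity.Theorems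

namespace BlowupRigidityOne

open Literature.Analysis.FluidPDE Literature.Analysis.FluidPDE.TaoCascade

variable {m : ℕ}

/-- **THE RENORMALISED VISCOUS BLOW-UPS.** See the module docstring.
[cite: Tao2016AveragedNS, §4 Thm. 4.2, the viscous equation before Thm. 4.2, §6.4; Teschl2012, §2.6] -/
theorem viscousBlowupProfile_of_noGlobalCascade {ε₀ R : ℝ} (hε : 0 < ε₀)
    {α : Fin m → Fin m → Fin m → ℤ × ℤ × ℤ → ℝ} {X₀ : Fin m → ℝ} (hα : InTableClass R α)
    (hNG : NoGlobalCascade ε₀ α X₀) :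
    ∃ κ : ℝ, 0 < κ ∧ ∀ ν : ℝ, 0 ≤ ν → ν * Real.sqrt 2 ≤ κ →
      ∃ (T : ℝ) (X : Fin m → ℤ → ℝ → ℝ), 0 < T ∧
        (∀ i n, ContDiffOn ℝ 1 (X i n) (Set.Ico 0 T)) ∧
        (∀ i n, X i n 0 = if n = 0 then X₀ i else 0) ∧
        (∀ i n t, n < 0 → X i n t = 0) ∧
        (∀ i n t, 0 ≤ t → t < T → derivWithin (X i n) (Set.Ici 0) t =
          quadTerm ε₀ α X i n t - ν * (1 + ε₀) ^ ((2 : ℝ) * n) * X i n t) ∧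
        (∀ t ∈ Ico (0 : ℝ) T, ∀ (i : Fin m) (k : ℤ), |X i k t| ≤ Real.sqrt (∑ j, X₀ j ^ 2)) ∧
        (∀ (K : ℤ) (L : ℝ), ∃ t : ℝ, 0 ≤ t ∧ t < T ∧
          ∃ (i : Fin m) (k : ℤ), K < k ∧ L < (1 + (1 + ε₀) ^ ((10 : ℝ) * k)) * |X i k t|) ∧
        ∀ W : ℤ → ℝ → Em m,
          (∀ n σ, W n σ = (bigLam ε₀ ^ n * Real.exp (-σ)) • shellVec X n (T - Real.exp (-σ))) →
          ∀ (n : ℤ) (σ : ℝ), Real.exp (-σ) < T →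
            HasDerivAt (W n)
              (-((1 : ℝ) • W n σ) + tableQ α (W n σ) + bigLam ε₀ • tableA α (W (n - 1) σ)
                + (bigLam ε₀)⁻¹ • tableB α (W (n + 1) σ) (W n σ)
                - (ν * ((1 + ε₀) ^ ((2 : ℝ) * n) * Real.exp (-σ))) • W n σ) σ := by
  obtain ⟨κ, hκ, H⟩ := viscousHighShellBlowup_of_noGlobalCascade hε hα hNG
  refine ⟨κ, hκ, fun ν hν hνκ => ?_⟩
  obtain ⟨T, X, hT, h1, h2, h3, h4, hamp, hhigh⟩ := H ν hν hνκ
  exact ⟨T, X, hT, h1, h2, h3, h4, hamp, hhigh, fun W hW n σ hσ =>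
    renormalisedViscousFlow_law hε h1 h4 hW n hσ⟩

end BlowupRigidityOne

end Summit.NavierStokesRegularity.NavierStokesRegularity.Theorems

end
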